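import Mathlib
import Summits.ResolutionOfSingularities.ResolutionOfSingularities.Theorems.RadicialJungCleanModelsLens5TFrameRG
import HarnessLib

/-!
# Route `RadicialJung`, crux `CleanModels` (stmt-15917): T⁗ port part 2/13 — §C immediate residues IR, §D first estimate (source :629–863; §C′, the `k`-rational bridge used only by the unported T′ corollaries, is dropped — its `valuation_algebraMap_eq_one` restates a landed declaration)

PORT (line lead `res-B-lead-1` g8, for Sketch rev 32) of res-B-lens-5's crux workfiles `Cruxes/DescentPerfectToAll/Lens5_TFrame.lean` rev 4
(crux ae884a356928; author res-B-lens-5 g15; `lean check` rc 0 · 0 sorries · 0 warnings; crit-1 TRIAGE-146/150 PASS) and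
`Cruxes/DescentPerfectToAll/Lens5_PDegreeCount.lean` rev 3 (crux 100289d6413b; TRIAGE-151 PASS): THEOREMS T⁗ / T⁗′ / T⁗″ / T⁗‴ — the slice
{`[Γ:pΓ] = p²`, `k` of FINITE `p`-rank `r`, `[κ_v : κ_v^p] = p^r`} of the research stub `stub_cleanLU3DefectNonDiscrete` (valuations of MINIMAL
Frobenius defect `d(K|K^p, v) = p`, ANY such ground field: no perfectness, no separability of `K/k` or `κ_v/k`), modulo F-02 `CossartPiltant2019` and
F-32 (`hEmb`) only.  The port is split into def-free modules `…Lens5TFrame{RG,IR,Graded,Port2,Port4Core,Layer,Layer2,Port4,Composition,PMon,PDegreeA,PDegreeB,PDegreeC}`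
over ONE currency module `…Lens5TFrameCurrency` (the authors' `def`s, verbatim); declarations VERBATIM, namespace
`Summit.ResolutionOfSingularities.ResolutionOfSingularities.Theorems.RadicialJungCleanModels.Lens5TFrame` (the authors' §A copy of
`Lens5_PDegreeSep` and the constant-frame corollaries `cleanLU3DefectPRankTwoSepFin_of_frame` / `…SepFin_of_cossartPiltant2019'` are not ported).
OURS · counted 0 · nothing here proves resolution in characteristic `p`.


-/

set_option linter.dupNamespace false -- mandated namespace of this single-conjunct summit

section

open IsLocalRing
open Literature.AlgebraicGeometry.Resolution
open Summit.ResolutionOfSingularities.ResolutionOfSingularities.Theorems.RadicialJung.CleanModels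
open Summit.ResolutionOfSingularities.ResolutionOfSingularities.Theorems.RadicialJung.CleanModels.Lens5
open Summit.ResolutionOfSingularities.ResolutionOfSingularities.Theorems.RadicialJung.CleanModels.Lens5.PRankTwoCurrency
open Summit.ResolutionOfSingularities.ResolutionOfSingularities.Theorems.RadicialJung.CleanModels.Lens5.PRankTwoAssembly
open Summit.ResolutionOfSingularities.ResolutionOfSingularities.Theorems.RadicialJungCleanModels.Lens5RegularityCriterion
open Summit.ResolutionOfSingularities.ResolutionOfSingularities.Theorems.RadicialJungCleanModels.Lens5ChartSurjection

namespace Summit.ResolutionOfSingularities.ResolutionOfSingularities.Theorems.RadicialJungCleanModels.Lens5TFrame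

/-- **IR (immediate residues of `K^p(g₀)`).**  If `g₀` has no best `p`-th-power approximation (`hdefect`: the radicial extension
`K(g₀^{1/p})/K` is immediate for `v`), every `v`-unit of `M = K^p(g₀)` is congruent to a `p`-th power modulo `𝔪_v`.  PROVED:
if not, `1, m, …, m^{p-1}` are residually `p`-independent (previous lemma), hence RG holds for `m` over `K^p` (§C); then, exactly as in
✓ `ImmediateValues.exists_valuation_eq_pthPower_of_noBestApprox`, `g₀ = Σ a_i m^i` over `K^p` and `a₀ = α₀^p` is a BEST `p`-th-power
approximation of `g₀`, contradicting `hdefect`. [folklore] -/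
theorem immediateResidues_of_noBestApprox {p : ℕ} [Fact p.Prime] {K : Type} [Field K] [CharP K p] (O : ValuationSubring K)
    (g₀ : K)
    (hdefect : ∀ f₀ : K, ∃ f₁ : K, O.valuation (g₀ - f₁ ^ p) < O.valuation (g₀ - f₀ ^ p))
    (M : Subfield K) (hM : ∀ x : K, x ∈ M ↔ ∃ c : Fin p → K, ∑ j, c j ^ p * g₀ ^ (j : ℕ) = x)
    (m : K) (hm : m ∈ M) (hvm : O.valuation m = 1) : ∃ w : K, O.valuation (m - w ^ p) < 1 := by
  classical
  have hpp : p.Prime := Fact.out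
  haveI : NeZero p := ⟨hpp.ne_zero⟩
  by_contra Hn
  push Not at Hn
  have hPI := residuallyPIndependent_of_not_residue_pthPower O m hvm Hn
  have hm0 : m ≠ 0 := fun h => by rw [h, map_zero] at hvm; exact zero_ne_one hvm
  set F : Subfield K := (frobenius K p).fieldRange with hF_def
  have hpowF : ∀ x : K, x ^ p ∈ F := fun x => RingHom.mem_fieldRange.mpr ⟨x, frobenius_def p x⟩
  have hFpow : ∀ a : K, a ∈ F → ∃ α : K, α ^ p = a := fun a ha => by
    obtain ⟨α, hα⟩ := RingHom.mem_fieldRange.mp ha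
    exact ⟨α, by rw [← hα, frobenius_def]⟩
  -- RG for `m` over `K^p` (§C with IR for `K^p` trivial)
  have hIRF : ∀ a : K, a ∈ F → O.valuation a = 1 → ∃ w : K, O.valuation (a - w ^ p) < 1 := by
    intro a ha _
    obtain ⟨α, rfl⟩ := hFpow a ha
    exact ⟨α, by rw [sub_self, map_zero]; exact zero_lt_one⟩
  have hRGm : ∀ c : Fin p → K, (∀ i, c i ∈ F) →
      O.valuation (∑ i : Fin p, c i * m ^ (i : ℕ)) = Finset.univ.sup (fun i => O.valuation (c i)) :=
    fun c hc => valuation_sum_mul_pow_eq_sup O F hIRF m hPI c hc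
  have hLI : LinearIndependent F (fun i : Fin p => m ^ (i : ℕ)) := by
    rw [Fintype.linearIndependent_iff]
    intro g hg i
    have hsum : ∑ i, (g i : K) * m ^ (i : ℕ) = 0 := by
      have : ∑ i, (g i : K) * m ^ (i : ℕ) = ∑ i, g i • m ^ (i : ℕ) :=
        Finset.sum_congr rfl fun i _ => (Subfield.smul_def (g i) _).symm
      rw [this, hg]
    have hv := hRGm (fun i => (g i : K)) (fun i => (g i).2)
    rw [hsum, map_zero] at hv
    have hle : O.valuation (g i : K) ≤ Finset.univ.sup (fun i => O.valuation (g i : K)) :=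
      Finset.le_sup (f := fun i => O.valuation (g i : K)) (Finset.mem_univ i)
    rw [← hv, le_zero_iff, map_eq_zero] at hle
    exact_mod_cast hle
  -- `g₀` in the `K^p`-basis `1, m, …, m^{p-1}` of `V(g₀)` (verbatim from ✓ `exists_valuation_eq_pthPower_of_noBestApprox`)
  set V : Submodule F K := Submodule.span F (Set.range fun j : Fin p => g₀ ^ (j : ℕ)) with hV_def
  haveI : Module.Finite F V := Module.Finite.span_of_finite F (Set.finite_range _)
  have hVfin : Module.finrank F V ≤ p := ImmediateValues.finrank_span_powers_le g₀
  have hg₀V : g₀ ∈ V := ImmediateValues.self_mem_span_powers g₀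
  have hmV : m ∈ V := by
    obtain ⟨c, rfl⟩ := (hM m).mp hm
    exact (ImmediateValues.mem_span_powers_iff g₀ _).mpr ⟨c, rfl⟩
  have hmpow : ∀ n : ℕ, m ^ n ∈ V := by
    intro n
    induction n with
    | zero => simpa using ImmediateValues.one_mem_span_powers (p := p) g₀
    | succ n ih => rw [pow_succ]; exact ImmediateValues.mul_mem_span_powers g₀ ih hmV
  set b : Fin p → V := fun i => ⟨m ^ (i : ℕ), hmpow i⟩ with hb_def
  have hbLI : LinearIndependent F b := by apply LinearIndependent.of_comp V.subtype; exact hLI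
  have hcard : Fintype.card (Fin p) = Module.finrank F V :=
    le_antisymm (hbLI.fintype_card_le_finrank) (by simpa using hVfin)
  haveI : Nonempty (Fin p) := ⟨⟨0, hpp.pos⟩⟩
  have hspan : Submodule.span F (Set.range b) = ⊤ := hbLI.span_eq_top_of_card_eq_finrank hcard
  have hg₀span : (⟨g₀, hg₀V⟩ : V) ∈ Submodule.span F (Set.range b) := by rw [hspan]; exact Submodule.mem_top
  obtain ⟨a, ha⟩ := (Submodule.mem_span_range_iff_exists_fun F).mp hg₀span
  have haK : ∑ i, (a i : K) * m ^ (i : ℕ) = g₀ := by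
    have := congrArg Subtype.val ha; simpa [hb_def, Subfield.smul_def] using this
  set j0 : Fin p := ⟨0, hpp.pos⟩ with hj0_def
  obtain ⟨α₀, hα₀⟩ := hFpow (a j0) (a j0).2
  set T := ∑ i ∈ (Finset.univ : Finset (Fin p)).erase j0, (a i : K) * m ^ (i : ℕ) with hT_def
  have hgT : g₀ - α₀ ^ p = T := by
    rw [← haK, ← Finset.add_sum_erase Finset.univ (fun i => (a i : K) * m ^ (i : ℕ)) (Finset.mem_univ j0), hα₀]
    simp [hj0_def, hT_def]
  -- `α₀` is a best approximation: by RG over `K^p`, `v (g₀ - f^p) = sup (v ((α₀ - f)^p), v (a_i), i ≥ 1) ≥ v T`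
  have hbound : ∀ f : K, O.valuation T ≤ O.valuation (g₀ - f ^ p) := by
    intro f
    let a' : Fin p → K := fun i => if i = j0 then (α₀ - f) ^ p else (a i : K)
    have ha'F : ∀ i, a' i ∈ F := by
      intro i; by_cases hi : i = j0 <;> simp only [a', hi, if_true, if_false]; exact hpowF _; exact (a i).2
    let a'' : Fin p → K := fun i => if i = j0 then 0 else (a i : K)
    have ha''F : ∀ i, a'' i ∈ F := by
      intro i; by_cases hi : i = j0 <;> simp only [a'', hi, if_true, if_false]; exact F.zero_mem; exact (a i).2
    have hTsum : T = ∑ i ∈ (Finset.univ : Finset (Fin p)).erase j0, a' i * m ^ (i : ℕ) := by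
      refine Finset.sum_congr rfl fun i hi => ?_
      have hij : i ≠ j0 := Finset.ne_of_mem_erase hi
      simp only [a', hij, if_false]
    have hTsum' : T = ∑ i, a'' i * m ^ (i : ℕ) := by
      rw [← Finset.add_sum_erase Finset.univ (fun i => a'' i * m ^ (i : ℕ)) (Finset.mem_univ j0)]
      have hrest : ∑ i ∈ (Finset.univ : Finset (Fin p)).erase j0, a'' i * m ^ (i : ℕ) = T := by
        refine Finset.sum_congr rfl fun i hi => ?_
        have hij : i ≠ j0 := Finset.ne_of_mem_erase hi
        simp only [a'', hij, if_false]
      rw [hrest]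
      simp only [a'', if_true, zero_mul, zero_add]
    have hdiff : g₀ - f ^ p = ∑ i, a' i * m ^ (i : ℕ) := by
      rw [← Finset.add_sum_erase Finset.univ (fun i => a' i * m ^ (i : ℕ)) (Finset.mem_univ j0), ← hTsum, ← hgT]
      simp only [a', if_true, hj0_def]; rw [sub_pow_char]; ring
    rw [hdiff, hRGm a' ha'F, hTsum', hRGm a'' ha''F]
    refine Finset.sup_mono_fun fun i _ => ?_
    by_cases hi : i = j0
    · simp only [a', a'', hi, if_true, map_zero]; exact zero_le
    · simp only [a', a'', hi, if_false]; exact le_rfl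
  obtain ⟨f₁, hf₁⟩ := hdefect α₀
  rw [hgT] at hf₁
  exact absurd (hbound f₁) (not_le.mpr hf₁)

/-! ## §D PORT 1′ — the doubly graded data -/

/-- **DG (double grading, term ≤ sum).**  Under (V) for `M`, (P2) for `x, y`, `v (B s) = 1` and RG for the finite family `B`
over `M`, each term of `Σ_{s,(a,b)} m_{s,ab} B_s x^a y^b` (`m ∈ M`) is bounded by the sum: the inner sums `c_{ab} := Σ_s m_{s,ab} B_s`
have `v(c_{ab}) = max_s v(m_{s,ab}) = v(m_{s₀,ab})` (RG), so the outer terms have pairwise distinct values (✓ `GradedBasis.monomial_values_ne`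
with the representatives `m_{s₀,ab} ∈ M`). [folklore] -/
theorem valuation_term_le_double_sum {p : ℕ} (hp : p.Prime) {K : Type} [Field K] (O : ValuationSubring K) (M : Subfield K)
    (hV : ∀ m : K, m ∈ M → m ≠ 0 → ∃ z : K, z ≠ 0 ∧ O.valuation m = O.valuation (z ^ p))
    {S : Type} [Fintype S] (B : S → K) (hB1 : ∀ s, O.valuation (B s) = 1)
    (hRG : ∀ c : S → K, (∀ i, c i ∈ M) →
      O.valuation (∑ i : S, c i * B i) = Finset.univ.sup (fun i => O.valuation (c i)))
    {x y : K} (hx : x ≠ 0) (hy : y ≠ 0)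
    (hP : ∀ a b : ℕ, a < p → b < p → (a ≠ 0 ∨ b ≠ 0) → ∀ z : K, z ≠ 0 → O.valuation (x ^ a * y ^ b) ≠ O.valuation (z ^ p))
    (m : S × (Fin p × Fin p) → K) (hm : ∀ l, m l ∈ M) (l₀ : S × (Fin p × Fin p)) :
    O.valuation (m l₀ * (B l₀.1 * (x ^ (l₀.2.1 : ℕ) * y ^ (l₀.2.2 : ℕ)))) ≤
      O.valuation (∑ l, m l * (B l.1 * (x ^ (l.2.1 : ℕ) * y ^ (l.2.2 : ℕ)))) := by
  classical
  haveI : NeZero p := ⟨hp.ne_zero⟩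
  set mon : Fin p × Fin p → K := fun ab => x ^ (ab.1 : ℕ) * y ^ (ab.2 : ℕ) with hmon
  set c : Fin p × Fin p → K := fun ab => ∑ i : S, m (i, ab) * B i with hc
  have hsum : ∑ l, m l * (B l.1 * (x ^ (l.2.1 : ℕ) * y ^ (l.2.2 : ℕ))) = ∑ ab, c ab * mon ab := by
    rw [Fintype.sum_prod_type, Finset.sum_comm]
    refine Finset.sum_congr rfl fun ab _ => ?_
    rw [hc, hmon]
    simp only
    rw [Finset.sum_mul]
    exact Finset.sum_congr rfl fun i _ => by ring
  have hvc : ∀ ab, O.valuation (c ab) = Finset.univ.sup (fun i => O.valuation (m (i, ab))) :=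
    fun ab => hRG _ (fun i => hm (i, ab))
  -- argmax representative of each non-zero coefficient
  have hrep : ∀ ab, c ab ≠ 0 → ∃ i₀, m (i₀, ab) ≠ 0 ∧ O.valuation (c ab) = O.valuation (m (i₀, ab)) := by
    intro ab hcab
    have hne : (Finset.univ : Finset S).Nonempty := by
      rw [Finset.univ_nonempty_iff]
      by_contra hS
      apply hcab
      rw [hc]
      exact Finset.sum_eq_zero fun i _ => (hS ⟨i⟩).elim
    obtain ⟨i₀, -, hi₀⟩ := Finset.exists_max_image Finset.univ (fun i => O.valuation (m (i, ab))) hne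
    have hsup : Finset.univ.sup (fun i => O.valuation (m (i, ab))) = O.valuation (m (i₀, ab)) :=
      le_antisymm (Finset.sup_le fun i hi => hi₀ i hi) (Finset.le_sup (f := fun i => O.valuation (m (i, ab))) (Finset.mem_univ i₀))
    refine ⟨i₀, ?_, (hvc ab).trans hsup⟩
    intro h0
    apply hcab
    have : O.valuation (c ab) = 0 := by rw [hvc ab, hsup, h0, map_zero]
    exact (map_eq_zero _).mp this
  -- pairwise distinct values of the `(a, b)`-terms
  have hpw : ∀ i ∈ (Finset.univ : Finset (Fin p × Fin p)), ∀ j ∈ (Finset.univ : Finset (Fin p × Fin p)), i ≠ j →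
      c i * mon i ≠ 0 → O.valuation (c i * mon i) ≠ O.valuation (c j * mon j) := by
    intro i _ j _ hij hi0
    have hci : c i ≠ 0 := fun h0 => hi0 (by rw [h0, zero_mul])
    by_cases hcj : c j = 0
    · rw [hcj, zero_mul, map_zero]; exact (Valuation.ne_zero_iff _).mpr hi0
    obtain ⟨a₀, ha₀, hva₀⟩ := hrep i hci
    obtain ⟨b₀, hb₀, hvb₀⟩ := hrep j hcj
    have hne := GradedBasis.monomial_values_ne hp O.valuation M hV hx hy hP i j hij (m (a₀, i)) (m (b₀, j)) (hm _) (hm _) ha₀ hb₀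
    intro heq
    apply hne
    rw [Valuation.map_mul _ (m (a₀, i)), Valuation.map_mul _ (m (b₀, j)), ← hva₀, ← hvb₀, ← Valuation.map_mul,
      ← Valuation.map_mul]
    simpa only [hmon] using heq
  have houter : O.valuation (∑ ab, c ab * mon ab) = Finset.univ.sup (fun ab => O.valuation (c ab * mon ab)) :=
    GradedBasis.valuation_sum_eq_sup_of_pairwise O.valuation Finset.univ _ hpw
  have hml₀ : m l₀ = m (l₀.1, l₀.2) := by rw [Prod.mk.eta]
  calc O.valuation (m l₀ * (B l₀.1 * (x ^ (l₀.2.1 : ℕ) * y ^ (l₀.2.2 : ℕ))))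
        = O.valuation (m l₀) * O.valuation (mon l₀.2) := by
          rw [map_mul, map_mul, hB1, one_mul]
    _ ≤ O.valuation (c l₀.2) * O.valuation (mon l₀.2) := by
          apply mul_le_mul_left
          rw [hvc, hml₀]
          exact Finset.le_sup (f := fun i => O.valuation (m (i, l₀.2))) (Finset.mem_univ l₀.1)
    _ = O.valuation (c l₀.2 * mon l₀.2) := (map_mul _ _ _).symm
    _ ≤ O.valuation (∑ ab, c ab * mon ab) := by
          rw [houter]; exact Finset.le_sup (f := fun ab => O.valuation (c ab * mon ab)) (Finset.mem_univ l₀.2)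
    _ = _ := by rw [hsum]

end Summit.ResolutionOfSingularities.ResolutionOfSingularities.Theorems.RadicialJungCleanModels.Lens5TFrame

end
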